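import Summits.AtomisticToContinuum.BoseEinsteinCondensation.Theorems.BECPalmDirectCorrelationStructureFactorFloorSolidCore
import Summits.AtomisticToContinuum.BoseEinsteinCondensation.Theorems.BECConjugateDominationInfraredMinimumUncertaintyFreeFisherGaussianity
import HarnessLib

/-!
# Route `BECPalmDirectCorrelation`, support item `StructureFactorFloor` (stmt-AtomisticToContinuum-12228):
# the free gas

Supports (does not close) stmt-AtomisticToContinuum-12228. The degenerate check (c) of the route's
falsifier list ("`v ≡ 0`: `S_m = 1`") as a theorem in the item's own vocabulary: the body of
`Summit.AtomisticToContinuum.BoseEinsteinCondensation.Theses.BECPalmDirectCorrelation.StructureFactorFloor`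
holds for the free gas `v = 0` — a CORELESS member of the smooth class, i.e. outside the solid-core
theorem `structureFactorFloor_smoothSolidCore`.

Proof: a minimiser of the free periodic energy is constant
(`InfraredMinimumUncertainty.Negative.exists_eq_const_of_free_minimiser`, torus Poincaré gap), and a
normalised constant has uncentred structure factor `S_m = 1` at every mode `m ≠ 0`
(`BECConjugateDomination.integral_norm_sq_densityMode_of_const`, orthogonality of the plane waves
`e_m(xⱼ)`); so the exact-minimiser floor of `PuffFloor` shape holds with `C = 0`
(`|k|/√(|k|² + 0) = 1 ≤ S_m`), and the transfer `structureFactorFloor_smooth_of_exactFloor` (spectral-gap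
`L²`-rigidity of near-minimisers + Minkowski) gives the item's conclusion on all `δ`-near-minimisers,
with `ρ₀ = 1`, `c = 1/8`, `ℓ = 2π`.
-/

noncomputable section

namespace Summit.AtomisticToContinuum.BoseEinsteinCondensation.Theorems

open MeasureTheory Filter Set Complex
open scoped ENNReal NNReal Topology BigOperators
open Literature.MathematicalPhysics.QuantumManyBody.BoseGas
open Summit.AtomisticToContinuum.BoseEinsteinCondensation.Theorems.InfraredMinimumUncertainty.Negative
  (exists_eq_const_of_free_minimiser)
open Summit.AtomisticToContinuum.BoseEinsteinCondensation.Theorems.BECConjugateDomination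
  (integral_norm_sq_densityMode_of_const norm_waveVec_pos)
open Summit.AtomisticToContinuum.BoseEinsteinCondensation.Theorems.StaticResponseBound.Negative
  (isRepulsiveFiniteRange_zero)

namespace StructureFactorFloor

/-- **The exact-minimiser floor of the free gas (`C = 0`): `1 ≤ S_m(Ψ₀)`** — a minimiser of the free
periodic energy is constant and a normalised constant has `S_m = 1` for `m ≠ 0`. [folklore] -/
theorem free_exactFloor {L : ℝ} (hL : 0 < L) {n : ℕ} (Ψ : PeriodicTrialState (n + 1) L)
    (hmin : periodicEnergy 0 Ψ = periodicGroundStateEnergy 0 (n + 1) L) {m : Fin 3 → ℤ} (hm : m ≠ 0)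
    (ρ : ℝ) :
    ‖(2 * Real.pi / L) • latticeVec 1 m‖ / Real.sqrt (‖(2 * Real.pi / L) • latticeVec 1 m‖ ^ 2 + 0 * ρ) ≤
      ((n : ℝ) + 1)⁻¹ *
        ∫ X in cellN (n + 1) L, ‖∑ j : Fin (n + 1), cellWave L m (X j)‖ ^ 2 * ‖Ψ.ψ X‖ ^ 2 := by
  obtain ⟨c, hc⟩ := exists_eq_const_of_free_minimiser hL Ψ hmin
  have hk := norm_waveVec_pos hL hm
  rw [integral_norm_sq_densityMode_of_const hL Ψ hc hm, zero_mul, add_zero, Real.sqrt_sq hk.le,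
    div_self hk.ne']
  push_cast
  rw [inv_mul_cancel₀ (by positivity)]

end StructureFactorFloor

open StructureFactorFloor

/-- **`StructureFactorFloor` holds for the free gas** (supports stmt-AtomisticToContinuum-12228): the body
of `Theses.BECPalmDirectCorrelation.StructureFactorFloor` at `v = 0`, verbatim — for `0 < ρ < 1` there
are `c, ℓ > 0` such that for all large `N = n+1` some `δ > 0` makes every `δ`-near-minimiser `Ψ` of the
free periodic energy on the torus of side `(N/ρ)^{1/3}` satisfy `S_m(Ψ) ≥ c·min(ℓ‖m/L‖, 1)` for all
`m ≠ 0`. The transfer `structureFactorFloor_smooth_of_exactFloor` applied to the free exact floor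
`free_exactFloor` (`C = 0`). [folklore] -/
theorem structureFactorFloor_free :
    ∃ ρ₀ : ℝ, 0 < ρ₀ ∧ ∀ ρ : ℝ, 0 < ρ → ρ < ρ₀ → ∃ c ℓ : ℝ, 0 < c ∧ 0 < ℓ ∧
      ∀ᶠ n : ℕ in Filter.atTop, let L : ℝ := sideLength ρ (n + 1);
      ∃ δ : ENNReal, 0 < δ ∧ ∀ Ψ : PeriodicTrialState (n + 1) L,
        periodicEnergy (0 : ℝ → ℝ≥0∞) Ψ ≤ periodicGroundStateEnergy (0 : ℝ → ℝ≥0∞) (n + 1) L + δ →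
        (let S : (Fin 3 → ℤ) → ENNReal := fun m => ((n + 1 : ℕ) : ENNReal)⁻¹ *
            (∫⁻ X in cellN (n + 1) L, (‖∑ j : Fin (n + 1), cellWave L m (X j)‖₊ : ENNReal) ^ 2 *
              (‖Ψ.ψ X‖₊ : ENNReal) ^ 2);
          ∀ m : Fin 3 → ℤ, m ≠ 0 →
            ENNReal.ofReal (c * min (ℓ * ‖latticeVec L⁻¹ m‖) 1) ≤ S m) := by
  have hC2 : ContDiff ℝ 2 (fun x : Space => (((0 : ℝ → ℝ≥0∞) ‖x‖)).toReal) := by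
    simpa using contDiff_const (c := (0 : ℝ))
  have hedge : ∃ Cₑ : ℝ, ∀ x : Space,
      ‖iteratedFDeriv ℝ 2 (fun x : Space => (((0 : ℝ → ℝ≥0∞) ‖x‖)).toReal) x‖ ≤
        Cₑ * Real.sqrt ((((0 : ℝ → ℝ≥0∞) ‖x‖)).toReal) := by
    refine ⟨0, fun x => ?_⟩
    have h0 : (fun x : Space => (((0 : ℝ → ℝ≥0∞) ‖x‖)).toReal) = fun _ => (0 : ℝ) := by
      funext x; simp
    rw [h0, iteratedFDeriv_fun_zero]
    simp
  refine ⟨1, one_pos, structureFactorFloor_smooth_of_exactFloor 0 isRepulsiveFiniteRange_zero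
    (fun r => by simp) hC2 hedge (C := 0) le_rfl fun ρ hρ _ => Eventually.of_forall fun n => ?_⟩
  intro Ψ hmin _ _ _ m hm
  exact free_exactFloor (sideLength_pos_of_pos hρ (Nat.succ_pos n)) Ψ hmin hm ρ

end Summit.AtomisticToContinuum.BoseEinsteinCondensation.Theorems

end
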